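import Summits.MatrixMultiplication.MatrixMultiplication.Theorems.GradedDesignFamily.Negative.NoTiling
import Literature.Combinatorics.Additive.TripleProductProperty

/-!
# Full-budget corollary: STPP families never tile more than `2|G| + 1` in the three pairings
# (crux `LevelGradedCohnUmans.GradedDesignFamily`, stmt-MatrixMultiplication-7610; negative side, lead c3)

At `J = ⊤` (all functions, `dim J = |G|`) a family is simultaneously `J`-separated exactly when it is an
STPP family in the sense of Cohn–Kleinberg–Szegedy–Umans 2005, Def. 5.1 (the tree's
`Literature.Combinatorics.Additive.SimultaneousTPP`): `stpp_simSep_top`.  Hence the family Neumann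
consequences of `Negative/NoTiling.lean` give NEW packing laws for STPP families in every finite group,
beyond the classical pairwise bounds `Σ_i |A_i||B_i| ≤ |G|` (which only give `3|G|` in total):

* `stpp_walls_sum_le` — `Σ_i (|A_i||B_i| + |B_i||C_i| + |C_i||A_i|) ≤ 2|G| + 1` (non-empty pieces);
* `stpp_sharp_cap` — `3·2^{1/3}·Σ_i (|A_i||B_i||C_i|)^{2/3} ≤ 2|G| + |A_{i₀}| + |C_{i₀}|` for every `i₀`:
  the total `Σ_i V_i^{2/3}` of an STPP family is at most `(0.529… + o(1))·|G|`, the same constant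
  `(2/(3√3))^{2/3}` as Neumann's single-triple bound `|S||T||U| ≤ ψ(|G|) ≈ 0.385|G|^{3/2}`; with
  singleton pieces (tricolored product-free sets `a_i b_j c_k = 1 ↔ i = j = k`): at most `(|G|+1)/2`
  triples (`stpp_walls_sum_le` with all cards `1`).

Sorry-free; axioms `propext`, `Classical.choice`, `Quot.sound`.
-/

set_option linter.dupNamespace false

noncomputable section

open scoped BigOperators
open Module Literature.Combinatorics.Additive

namespace Summit.MatrixMultiplication.MatrixMultiplication.Theorems.GradedDesignFamily.Negative

/-- **STPP ⇒ simultaneous `⊤`-separation.**  An STPP family (CKSU Def. 5.1) is simultaneously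
separated by ALL functions: the indicator of `x₀⁻¹ z₀` separates the target `(x₀, z₀)` of block `i`
(clause (ii) pins the blocks, clause (i) the elements). -/
theorem stpp_simSep_top {G : Type} [Group G] [DecidableEq G] {ι : Type} (A B C : ι → Finset G)
    (h : SimultaneousTPP A B C) :
    ∀ i : ι, ∀ x₀ ∈ A i, ∀ z₀ ∈ C i, ∃ f ∈ (⊤ : Submodule ℂ (G → ℂ)), ∀ a b : ι, ∀ x ∈ A a,
      ∀ y ∈ B a, ∀ y' ∈ B b, ∀ z ∈ C b,
        ((a = i ∧ b = i ∧ x = x₀ ∧ y = y' ∧ z = z₀) → f (x⁻¹ * y * y'⁻¹ * z) = 1) ∧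
        (¬ (a = i ∧ b = i ∧ x = x₀ ∧ y = y' ∧ z = z₀) → f (x⁻¹ * y * y'⁻¹ * z) = 0) := by
  intro i x₀ hx₀ z₀ hz₀
  refine ⟨fun g => if g = x₀⁻¹ * z₀ then 1 else 0, Submodule.mem_top, ?_⟩
  intro a b x hx y hy y' hy' z hz
  constructor
  · rintro ⟨-, -, rfl, rfl, rfl⟩
    simp
  · intro hne
    show (if x⁻¹ * y * y'⁻¹ * z = x₀⁻¹ * z₀ then (1 : ℂ) else 0) = 0
    rw [if_neg]
    intro heq
    apply hne
    -- clause (ii): the blocks coincide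
    have hword : x₀ * x⁻¹ * y * y'⁻¹ * z * z₀⁻¹ = 1 := by
      have : x₀ * (x⁻¹ * y * y'⁻¹ * z) * z₀⁻¹ = 1 := by rw [heq]; group
      simpa [mul_assoc] using this
    obtain ⟨hia, hab⟩ := h.2 i a b x₀ hx₀ x hx y hy y' hy' z hz z₀ hz₀ hword
    subst hia; subst hab
    -- clause (i): the elements coincide
    have hword' : x₀ * x⁻¹ * (y * y'⁻¹) * (z * z₀⁻¹) = 1 := by
      simpa [mul_assoc] using hword
    obtain ⟨hx', hy'', hz'⟩ := h.1 i x₀ hx₀ x hx y hy y' hy' z hz z₀ hz₀ hword'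
    exact ⟨rfl, rfl, hx'.symm, hy'', hz'⟩

/-- `dim ⊤ = |G|` for the space of all complex functions on a finite group. -/
theorem finrank_top_fun {G : Type} [Fintype G] :
    Module.finrank ℂ (⊤ : Submodule ℂ (G → ℂ)) = Fintype.card G := by
  rw [finrank_top, Module.finrank_fintype_fun_eq_card]

/-- **STPP walls sum law.**  For an STPP family (CKSU Def. 5.1) with non-empty pieces in a finite
group, `Σ_i (|A_i||B_i| + |B_i||C_i| + |C_i||A_i|) ≤ 2|G| + 1` (the classical pairwise packing bounds
give only `3|G|`).  With singleton pieces: a tricolored product-free set has `≤ (|G|+1)/2` triples. -/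
theorem stpp_walls_sum_le {G : Type} [Group G] [Fintype G] [DecidableEq G] {ι : Type} [Fintype ι]
    (A B C : ι → Finset G) (h : SimultaneousTPP A B C) (hA : ∀ i, (A i).Nonempty)
    (hB : ∀ i, (B i).Nonempty) (hC : ∀ i, (C i).Nonempty) :
    ∑ i, ((A i).card * (B i).card + (B i).card * (C i).card + (C i).card * (A i).card) ≤
      2 * Fintype.card G + 1 := by
  have hsep := stpp_simSep_top A B C h
  have hW := familyWalls_sum_le (⊤ : Submodule ℂ (G → ℂ)) (fun _ _ _ _ => Submodule.mem_top)
    A B C hA hB hC hsep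
  rwa [finrank_top_fun] at hW

/-- **STPP sharp cap.**  For an STPP family (CKSU Def. 5.1) with non-empty pieces in a finite group and
every block `i₀`, `3·2^{1/3}·Σ_i (|A_i||B_i||C_i|)^{2/3} ≤ 2|G| + |A_{i₀}| + |C_{i₀}|`: in total an STPP
family covers at most `(2/(3·2^{1/3}) + o(1))·|G| = (0.529… + o(1))·|G|` in the measure `Σ V_i^{2/3}`,
the same constant as a single TPP triple under Neumann's bound. -/
theorem stpp_sharp_cap {G : Type} [Group G] [Fintype G] [DecidableEq G] {ι : Type} [Fintype ι]
    (A B C : ι → Finset G) (h : SimultaneousTPP A B C) (hA : ∀ i, (A i).Nonempty)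
    (hB : ∀ i, (B i).Nonempty) (hC : ∀ i, (C i).Nonempty) (i₀ : ι) :
    3 * (2 : ℝ) ^ ((1 : ℝ) / 3) *
        ∑ i, (((A i).card * (B i).card * (C i).card : ℕ) : ℝ) ^ ((2 : ℝ) / 3) ≤
      2 * (Fintype.card G : ℝ) + (A i₀).card + (C i₀).card := by
  have hsep := stpp_simSep_top A B C h
  have hcap := sharp_family_cap (⊤ : Submodule ℂ (G → ℂ)) (fun _ _ _ _ => Submodule.mem_top)
    A B C hA hB hC hsep i₀
  rwa [finrank_top_fun] at hcap

end Summit.MatrixMultiplication.MatrixMultiplication.Theorems.GradedDesignFamily.Negative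

end
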